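import Mathlib
import HarnessLib
import Summits.HubbardSuperconductivity.HubbardSuperconductivity.Theorems.KLProgrammeKLRegimeTorusMixedLayerCake

/-!
# Route `KLProgramme` — engine support (route (L2), ADDITIVE weight, FIRST MOMENT, MIXED ORDERS along the tangent): the squared isotropic
# distance weight against the inverse of the additive weight `1 + X⁶ + I₁⁶ + I₂⁶ + Y⁶ + Z⁴ + Z'⁶` is summable on `(ℤ/Pℤ)¹ × (ℤ/Lℤ)²`,
# uniformly in `(P, L)` — the tangent direction carries a QUARTIC term at the anisotropic rate `s₃` and a SEXTIC term at the
# isotropic rate `s₃'`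

Cell `gate-hubbard-kl`, seat p3 (g10), for the ENGINE child stmt-HubbardSuperconductivity-20437 (`stub_engine_step_norms`: the WEIGHTED lines
`KernelNormsWt4 … K_n j`, `j ≥ 1`, and conjunct 3 (E4)ₙ through W1 = the weighted torus bound of the level-`n` anisotropic sector functions;
located risk «(b)-Wt@j≥1»).  The order-three file `…TorusAdditiveSexticWeightMoment` (p3 g9) asks for THIRD differences along the sector
tangent `v` at the anisotropic rate `s₃ ≍ Λ_n` — finding W1-TAN3 (KL STATUS 2026-08-27 15:19Z): on the flow frame that datum is not n-free
(the isotropic (I-F jets) give `‖D³K_n‖ ≲ U²4ⁿ`, an overshoot `U²2ⁿ` along the tangent).  What IS available n-free along `v`: SECOND differences at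
the anisotropic rate `s₃` (`C²` band data) and THIRD differences at the isotropic rate `s₃' ≍ s₂` (`C³` data).  This file is the `Σ w²W⁻¹`
factor of the corresponding `ℓ²` route: decay variables `X = s₀|j̃|`, `I₁ = s₁|z̃₁|`, `I₂ = s₁|z̃₂|`, `Y = s₂|ã_{v⊥}(z)|`, `Z = s₃|ã_v(z)|`,
`Z' = s₃'|ã_v(z)|`, weight `W = 1 + X⁶ + I₁⁶ + I₂⁶ + Y⁶ + Z⁴ + Z'⁶`, moment numerator `(1 + X + I₁ + I₂)²`:

  **`sum_sq_mul_inv_mixedWeight_le`**: for `v ≠ 0`, `2(|v₁|+|v₂|)R₀ < L`,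
  `Σ_{(j,z)} (1 + X + I₁ + I₂)²·W⁻¹ ≤ 524288·(1/s₀ + 1)·[C_w'²·(2√2/(s₂|v|) + 2)(2√2/(s₃|v|) + 2) + (1/s₁ + 1)²/(1 + s₁R₀)]`,
  `C_w' = 1 + 2√2·s₁/(s₂|v|) + 2√2·s₁/(s₃'|v|)` — the phase-space size `(1/s₀)(|v|/s₂)(|v|/s₃)` is that of the ANISOTROPIC rates, the moment
  constant `C_w'` reads the ISOTROPIC tangent rate `s₃'` (`s₁/(s₃'|v|) = O(1)` on a sector); near region by the mixed-base layer cake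
  `sum_sq_mul_inv_le_of_mixed_levels` + the two-radii rotated-box count `card_filter_frame_near_le'` (`…TorusMixedLayerCake`), far region verbatim
  from the order-three file (`sq_mul_inv_one_add_sextic_le`, `sum_inv_pow_le_of_card_le_cubic`).

Everything is proved; no definitions, no named facts. [folklore]

References: G. Benfatto, A. Giuliani, V. Mastropietro, Ann. Henri Poincaré 7 (2006) 809–898, Lemma 2.2 (2.52)–(2.55) (tangential derivatives
cost `γ^{-h/2}` up to order two and `γ^{-h}` beyond, (2.55)), §2.6 (2.81) and footnote ¹.
-/

noncomputable section

namespace Summit.HubbardSuperconductivity.HubbardSuperconductivity.Theorems.TorusFourierL2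

set_option linter.dupNamespace false -- summit = problem name (single-conjunct summit), D-0017

open Finset Literature.Probability.LatticeModels
open scoped Real

/-! ### §3 The moment sum -/

set_option maxHeartbeats 400000 in -- four pointwise/count blocks in one induction-free assembly (as the order-three file)
/-- **The squared isotropic distance weight against the inverse MIXED additive weight is summable on the space-time torus, uniformly in `(P, L)`.**
For rates `s₀, s₁, s₂, s₃, s₃' > 0`, an integer direction `v ≠ 0` (frame `(v⊥, v)`, `|v| = √(v₁² + v₂²)`) and a near radius `R₀` with `2(|v₁|+|v₂|)R₀ < L`:
`Σ_{(j,z)} (1 + s₀|j̃| + s₁|z̃₁| + s₁|z̃₂|)²·(1 + (s₀|j̃|)⁶ + (s₁|z̃₁|)⁶ + (s₁|z̃₂|)⁶ + (s₂|ã_{v⊥}(z)|)⁶ + (s₃|ã_v(z)|)⁴ + (s₃'|ã_v(z)|)⁶)⁻¹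
  ≤ 524288·(1/s₀ + 1)·[C_w'²·(2√2/(s₂|v|) + 2)(2√2/(s₃|v|) + 2) + (1/s₁ + 1)²/(1 + s₁R₀)]`, `C_w' = 1 + 2√2·s₁/(s₂|v|) + 2√2·s₁/(s₃'|v|)`
— the `Σ w²W⁻¹` factor of the `ℓ²` route to the FIRST MOMENT of a space-time lattice kernel when the tangent direction `v` carries SECOND differences at
the rate `s₃` and THIRD differences at the rate `s₃'` on the Plancherel side. [cite: BenfattoGiulianiMastropietro2006, §2.6 (2.81) and footnote 1] -/
theorem sum_sq_mul_inv_mixedWeight_le {P L : ℕ} [NeZero P] [NeZero L] (v : Fin 2 → ℤ) (hv : v ≠ 0) {s₀ s₁ s₂ s₃ s₃' : ℝ}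
    (hs₀ : 0 < s₀) (hs₁ : 0 < s₁) (hs₂ : 0 < s₂) (hs₃ : 0 < s₃) (hs₃' : 0 < s₃') {R₀ : ℕ} (hR₀ : 2 * (|v 0| + |v 1|) * (R₀ : ℤ) < L) :
    ∑ q : TorusSite 1 P × TorusSite 2 L,
      (1 + s₀ * |(((q.1 0).valMinAbs : ℤ) : ℝ)| + s₁ * |(((q.2 0).valMinAbs : ℤ) : ℝ)| + s₁ * |(((q.2 1).valMinAbs : ℤ) : ℝ)|) ^ 2 *
      (1 + (s₀ * |(((q.1 0).valMinAbs : ℤ) : ℝ)|) ^ 6 + (s₁ * |(((q.2 0).valMinAbs : ℤ) : ℝ)|) ^ 6 +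
        (s₁ * |(((q.2 1).valMinAbs : ℤ) : ℝ)|) ^ 6 +
        (s₂ * |(((∑ j, ((![-v 1, v 0] j : ℤ) : ZMod L) * q.2 j).valMinAbs : ℤ) : ℝ)|) ^ 6 +
        (s₃ * |(((∑ j, ((v j : ℤ) : ZMod L) * q.2 j).valMinAbs : ℤ) : ℝ)|) ^ 4 +
        (s₃' * |(((∑ j, ((v j : ℤ) : ZMod L) * q.2 j).valMinAbs : ℤ) : ℝ)|) ^ 6)⁻¹ ≤
      524288 * (1 / s₀ + 1) *
        ((1 + 2 * Real.sqrt 2 * s₁ / (s₂ * Real.sqrt ((v 0 : ℝ) ^ 2 + (v 1 : ℝ) ^ 2)) +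
            2 * Real.sqrt 2 * s₁ / (s₃' * Real.sqrt ((v 0 : ℝ) ^ 2 + (v 1 : ℝ) ^ 2))) ^ 2 *
          ((2 * Real.sqrt 2 / (s₂ * Real.sqrt ((v 0 : ℝ) ^ 2 + (v 1 : ℝ) ^ 2)) + 2) *
            (2 * Real.sqrt 2 / (s₃ * Real.sqrt ((v 0 : ℝ) ^ 2 + (v 1 : ℝ) ^ 2)) + 2))
          + (1 / s₁ + 1) ^ 2 / (1 + s₁ * R₀)) := by
  classical
  -- the six decay variables
  set X : TorusSite 1 P × TorusSite 2 L → ℝ := fun q => s₀ * |(((q.1 0).valMinAbs : ℤ) : ℝ)| with hX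
  set I₁ : TorusSite 1 P × TorusSite 2 L → ℝ := fun q => s₁ * |(((q.2 0).valMinAbs : ℤ) : ℝ)| with hI₁
  set I₂ : TorusSite 1 P × TorusSite 2 L → ℝ := fun q => s₁ * |(((q.2 1).valMinAbs : ℤ) : ℝ)| with hI₂
  set Y : TorusSite 1 P × TorusSite 2 L → ℝ := fun q =>
    s₂ * |(((∑ j, ((![-v 1, v 0] j : ℤ) : ZMod L) * q.2 j).valMinAbs : ℤ) : ℝ)| with hY
  set Z : TorusSite 1 P × TorusSite 2 L → ℝ := fun q =>
    s₃ * |(((∑ j, ((v j : ℤ) : ZMod L) * q.2 j).valMinAbs : ℤ) : ℝ)| with hZ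
  set Z' : TorusSite 1 P × TorusSite 2 L → ℝ := fun q =>
    s₃' * |(((∑ j, ((v j : ℤ) : ZMod L) * q.2 j).valMinAbs : ℤ) : ℝ)| with hZ'
  have hX0 : ∀ q, 0 ≤ X q := fun q => by positivity
  have hI₁0 : ∀ q, 0 ≤ I₁ q := fun q => by positivity
  have hI₂0 : ∀ q, 0 ≤ I₂ q := fun q => by positivity
  have hY0 : ∀ q, 0 ≤ Y q := fun q => by positivity
  have hZ0 : ∀ q, 0 ≤ Z q := fun q => by positivity
  have hZ'0 : ∀ q, 0 ≤ Z' q := fun q => by positivity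
  -- near / far
  let near : TorusSite 1 P × TorusSite 2 L → Prop := fun q => ∀ i, |((q.2 i).valMinAbs : ℤ)| ≤ R₀
  set Sn := (univ : Finset (TorusSite 1 P × TorusSite 2 L)).filter (fun q => near q) with hSn
  set Sf := (univ : Finset (TorusSite 1 P × TorusSite 2 L)).filter (fun q => ¬ near q) with hSf
  set ff : TorusSite 1 P × TorusSite 2 L → ℝ := fun q => 1 + X q + I₁ q + I₂ q with hff
  -- constants
  set r : ℝ := Real.sqrt ((v 0 : ℝ) ^ 2 + (v 1 : ℝ) ^ 2) with hr
  set Cw : ℝ := 1 + 2 * Real.sqrt 2 * s₁ / (s₂ * r) + 2 * Real.sqrt 2 * s₁ / (s₃' * r) with hCw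
  set An : ℝ := 4 * (1 / s₀ + 1) * ((2 * Real.sqrt 2 / (s₂ * r) + 2) * (2 * Real.sqrt 2 / (s₃ * r) + 2)) with hAn
  set Af : ℝ := 4 * (1 / s₀ + 1) * (4 * (1 / s₁ + 1) ^ 2) with hAf
  have hv2 : (0 : ℝ) < (v 0 : ℝ) ^ 2 + (v 1 : ℝ) ^ 2 := by
    rcases Function.ne_iff.1 hv with ⟨i, hi⟩
    fin_cases i
    · have : (v 0 : ℝ) ≠ 0 := by exact_mod_cast hi
      positivity
    · have : (v 1 : ℝ) ≠ 0 := by exact_mod_cast hi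
      positivity
  have hr0 : 0 < r := Real.sqrt_pos.2 hv2
  have hCw1 : 1 ≤ Cw := by
    rw [hCw]
    have h1 : 0 ≤ 2 * Real.sqrt 2 * s₁ / (s₂ * r) := by positivity
    have h2 : 0 ≤ 2 * Real.sqrt 2 * s₁ / (s₃' * r) := by positivity
    linarith
  have hCw0 : 0 ≤ Cw := zero_le_one.trans hCw1
  have hAn0 : 0 ≤ An := by positivity
  have hAf0 : 0 ≤ Af := by positivity
  -- (1) near: the moment numerator is `≤ Cw·(1 + X + Y + Z')`
  have hnear_mom : ∀ q ∈ Sn, ff q ≤ Cw * (1 + X q + Y q + Z' q) := by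
    intro q hq
    have hqn : near q := (mem_filter.1 hq).2
    obtain ⟨e1, e2⟩ := valMinAbs_frame_eq_of_near v hR₀ q.2 hqn
    have hfr := abs_add_abs_le_of_frame_eq (z₀ := (((q.2 0).valMinAbs : ℤ) : ℝ)) (z₁ := (((q.2 1).valMinAbs : ℤ) : ℝ)) hv e1 e2
    have hI : I₁ q + I₂ q ≤ 2 * Real.sqrt 2 * s₁ / (s₂ * r) * Y q + 2 * Real.sqrt 2 * s₁ / (s₃' * r) * Z' q := by
      have h := mul_le_mul_of_nonneg_left hfr hs₁.le
      rw [← hr] at h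
      have eI : I₁ q + I₂ q = s₁ * (|(((q.2 0).valMinAbs : ℤ) : ℝ)| + |(((q.2 1).valMinAbs : ℤ) : ℝ)|) := by
        simp only [hI₁, hI₂]; ring
      have eY : 2 * Real.sqrt 2 * s₁ / (s₂ * r) * Y q =
          s₁ * (2 * Real.sqrt 2 / r) * |(((∑ j, ((![-v 1, v 0] j : ℤ) : ZMod L) * q.2 j).valMinAbs : ℤ) : ℝ)| := by
        simp only [hY]; field_simp
      have eZ : 2 * Real.sqrt 2 * s₁ / (s₃' * r) * Z' q =
          s₁ * (2 * Real.sqrt 2 / r) * |(((∑ j, ((v j : ℤ) : ZMod L) * q.2 j).valMinAbs : ℤ) : ℝ)| := by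
        simp only [hZ']; field_simp
      rw [eI, eY, eZ]
      have : s₁ * (2 * Real.sqrt 2 / r * (|(((∑ j, ((![-v 1, v 0] j : ℤ) : ZMod L) * q.2 j).valMinAbs : ℤ) : ℝ)| +
          |(((∑ j, ((v j : ℤ) : ZMod L) * q.2 j).valMinAbs : ℤ) : ℝ)|)) =
          s₁ * (2 * Real.sqrt 2 / r) * |(((∑ j, ((![-v 1, v 0] j : ℤ) : ZMod L) * q.2 j).valMinAbs : ℤ) : ℝ)| +
            s₁ * (2 * Real.sqrt 2 / r) * |(((∑ j, ((v j : ℤ) : ZMod L) * q.2 j).valMinAbs : ℤ) : ℝ)| := by ring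
      rw [← this]
      exact h
    have c1 : 2 * Real.sqrt 2 * s₁ / (s₂ * r) ≤ Cw := by
      rw [hCw]; have : 0 ≤ 2 * Real.sqrt 2 * s₁ / (s₃' * r) := by positivity
      linarith
    have c2 : 2 * Real.sqrt 2 * s₁ / (s₃' * r) ≤ Cw := by
      rw [hCw]; have : 0 ≤ 2 * Real.sqrt 2 * s₁ / (s₂ * r) := by positivity
      linarith
    have hYc : 2 * Real.sqrt 2 * s₁ / (s₂ * r) * Y q ≤ Cw * Y q := mul_le_mul_of_nonneg_right c1 (hY0 q)
    have hZc : 2 * Real.sqrt 2 * s₁ / (s₃' * r) * Z' q ≤ Cw * Z' q := mul_le_mul_of_nonneg_right c2 (hZ'0 q)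
    have hXc : 1 + X q ≤ Cw * (1 + X q) := le_mul_of_one_le_left (by linarith [hX0 q]) hCw1
    simp only [hff]
    nlinarith [hI, hYc, hZc, hXc]
  -- (2) near: the count of the mixed boxes
  have hcount_near : ∀ k : ℕ, (((Sn.filter fun q => X q ≤ (4 : ℝ) ^ k ∧ Y q ≤ (4 : ℝ) ^ k ∧ Z q ≤ (8 : ℝ) ^ k).card : ℕ) : ℝ) ≤
      An * (128 : ℝ) ^ k := by
    intro k
    have h4 : (1 : ℝ) ≤ (4 : ℝ) ^ k := one_le_pow₀ (by norm_num)
    have h8 : (1 : ℝ) ≤ (8 : ℝ) ^ k := one_le_pow₀ (by norm_num)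
    have hsub : (Sn.filter fun q => X q ≤ (4 : ℝ) ^ k ∧ Y q ≤ (4 : ℝ) ^ k ∧ Z q ≤ (8 : ℝ) ^ k) ⊆
        univ.filter (fun q : TorusSite 1 P × TorusSite 2 L =>
          s₀ * |(((q.1 0).valMinAbs : ℤ) : ℝ)| ≤ (4 : ℝ) ^ k ∧
          (s₂ * |(-(v 1 : ℝ)) * (((q.2 0).valMinAbs : ℤ) : ℝ) + (v 0 : ℝ) * (((q.2 1).valMinAbs : ℤ) : ℝ)| ≤ (4 : ℝ) ^ k ∧
            s₃ * |(v 0 : ℝ) * (((q.2 0).valMinAbs : ℤ) : ℝ) + (v 1 : ℝ) * (((q.2 1).valMinAbs : ℤ) : ℝ)| ≤ (8 : ℝ) ^ k)) := by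
      intro q hq
      rw [mem_filter] at hq
      have hqn : near q := (mem_filter.1 hq.1).2
      obtain ⟨hx, hy, hz⟩ := hq.2
      obtain ⟨e1, e2⟩ := valMinAbs_frame_eq_of_near v hR₀ q.2 hqn
      refine mem_filter.2 ⟨mem_univ _, ?_, ?_, ?_⟩
      · simpa [hX] using hx
      · rw [hY] at hy; dsimp only at hy; rwa [e1] at hy
      · rw [hZ] at hz; dsimp only at hz; rwa [e2] at hz
    have hprod := card_filter_prod_and_le (fun j : TorusSite 1 P => s₀ * |(((j 0).valMinAbs : ℤ) : ℝ)| ≤ (4 : ℝ) ^ k)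
      (fun z : TorusSite 2 L =>
        s₂ * |(-(v 1 : ℝ)) * (((z 0).valMinAbs : ℤ) : ℝ) + (v 0 : ℝ) * (((z 1).valMinAbs : ℤ) : ℝ)| ≤ (4 : ℝ) ^ k ∧
          s₃ * |(v 0 : ℝ) * (((z 0).valMinAbs : ℤ) : ℝ) + (v 1 : ℝ) * (((z 1).valMinAbs : ℤ) : ℝ)| ≤ (8 : ℝ) ^ k)
      (fun q : TorusSite 1 P × TorusSite 2 L =>
        s₀ * |(((q.1 0).valMinAbs : ℤ) : ℝ)| ≤ (4 : ℝ) ^ k ∧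
        (s₂ * |(-(v 1 : ℝ)) * (((q.2 0).valMinAbs : ℤ) : ℝ) + (v 0 : ℝ) * (((q.2 1).valMinAbs : ℤ) : ℝ)| ≤ (4 : ℝ) ^ k ∧
          s₃ * |(v 0 : ℝ) * (((q.2 0).valMinAbs : ℤ) : ℝ) + (v 1 : ℝ) * (((q.2 1).valMinAbs : ℤ) : ℝ)| ≤ (8 : ℝ) ^ k))
      (fun q h => h)
    have h1 := card_filter_time_le (P := P) hs₀ h4
    have h2 := card_filter_frame_near_le' (L := L) v hv hs₂ hs₃ h4 h8
    have e128 : (4 : ℝ) ^ k * ((4 : ℝ) ^ k * (8 : ℝ) ^ k) = (128 : ℝ) ^ k := by rw [← mul_pow, ← mul_pow]; norm_num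
    calc (((Sn.filter fun q => X q ≤ (4 : ℝ) ^ k ∧ Y q ≤ (4 : ℝ) ^ k ∧ Z q ≤ (8 : ℝ) ^ k).card : ℕ) : ℝ)
        ≤ ((univ.filter (fun j : TorusSite 1 P => s₀ * |(((j 0).valMinAbs : ℤ) : ℝ)| ≤ (4 : ℝ) ^ k)).card : ℝ) *
          ((univ.filter (fun z : TorusSite 2 L =>
            s₂ * |(-(v 1 : ℝ)) * (((z 0).valMinAbs : ℤ) : ℝ) + (v 0 : ℝ) * (((z 1).valMinAbs : ℤ) : ℝ)| ≤ (4 : ℝ) ^ k ∧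
            s₃ * |(v 0 : ℝ) * (((z 0).valMinAbs : ℤ) : ℝ) + (v 1 : ℝ) * (((z 1).valMinAbs : ℤ) : ℝ)| ≤ (8 : ℝ) ^ k)).card : ℝ) := by
          exact_mod_cast (card_le_card hsub).trans hprod
      _ ≤ (4 * (1 / s₀ + 1) * (4 : ℝ) ^ k) *
          (((2 * Real.sqrt 2 / (s₂ * r) + 2) * (2 * Real.sqrt 2 / (s₃ * r) + 2)) * ((4 : ℝ) ^ k * (8 : ℝ) ^ k)) :=
          mul_le_mul h1 h2 (by positivity) (by positivity)
      _ = An * (128 : ℝ) ^ k := by rw [hAn, ← e128]; ring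
  -- (3) near: the mixed layer cake
  have hnear_sum : ∑ q ∈ Sn, ff q ^ 2 * (1 + X q ^ 6 + Y q ^ 6 + Z q ^ 4 + Z' q ^ 6)⁻¹ ≤ 131072 * An * Cw ^ 2 :=
    sum_sq_mul_inv_le_of_mixed_levels Sn X Y Z Z' ff (fun q _ => hX0 q) (fun q _ => hY0 q) (fun q _ => hZ0 q) (fun q _ => hZ'0 q)
      (fun q _ => by simp only [hff]; linarith [hX0 q, hI₁0 q, hI₂0 q]) hnear_mom hAn0 hcount_near
  have hnear_pt : ∀ q, ff q ^ 2 * (1 + X q ^ 6 + I₁ q ^ 6 + I₂ q ^ 6 + Y q ^ 6 + Z q ^ 4 + Z' q ^ 6)⁻¹ ≤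
      ff q ^ 2 * (1 + X q ^ 6 + Y q ^ 6 + Z q ^ 4 + Z' q ^ 6)⁻¹ := by
    intro q
    refine mul_le_mul_of_nonneg_left (inv_anti₀ (by positivity) ?_) (by positivity)
    nlinarith [pow_nonneg (hI₁0 q) 6, pow_nonneg (hI₂0 q) 6]
  -- (4) far: verbatim from the order-three file
  have hfar_pt : ∀ q, ff q ^ 2 * (1 + X q ^ 6 + I₁ q ^ 6 + I₂ q ^ 6 + Y q ^ 6 + Z q ^ 4 + Z' q ^ 6)⁻¹ ≤ 1024 * (ff q)⁻¹ ^ 4 := by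
    intro q
    have h1 : (1 + X q ^ 6 + I₁ q ^ 6 + I₂ q ^ 6 + Y q ^ 6 + Z q ^ 4 + Z' q ^ 6)⁻¹ ≤ (1 + X q ^ 6 + I₁ q ^ 6 + I₂ q ^ 6)⁻¹ :=
      inv_anti₀ (by positivity) (by nlinarith [pow_nonneg (hY0 q) 6, pow_nonneg (hZ0 q) 4, pow_nonneg (hZ'0 q) 6])
    have hff0 : 0 ≤ ff q := by simp only [hff]; linarith [hX0 q, hI₁0 q, hI₂0 q]
    calc ff q ^ 2 * (1 + X q ^ 6 + I₁ q ^ 6 + I₂ q ^ 6 + Y q ^ 6 + Z q ^ 4 + Z' q ^ 6)⁻¹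
        ≤ ff q ^ 2 * (1 + X q ^ 6 + I₁ q ^ 6 + I₂ q ^ 6)⁻¹ := mul_le_mul_of_nonneg_left h1 (by positivity)
      _ ≤ 1024 * 1 ^ 2 * (1 + X q + I₁ q + I₂ q)⁻¹ ^ 4 :=
          sq_mul_inv_one_add_sextic_le (hX0 q) (hI₁0 q) (hI₂0 q) hff0 (C := 1) (by simp [hff])
      _ = 1024 * (ff q)⁻¹ ^ 4 := by rw [hff]; ring
  have hcount_far : ∀ R : ℝ, 1 ≤ R → (((Sf.filter fun q => ff q ≤ R).card : ℕ) : ℝ) ≤ Af * R ^ 3 := by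
    intro R hR
    have hsub : (Sf.filter fun q => ff q ≤ R) ⊆ univ.filter (fun q : TorusSite 1 P × TorusSite 2 L =>
        s₀ * |(((q.1 0).valMinAbs : ℤ) : ℝ)| ≤ R ∧
        1 + s₁ * (|(((q.2 0).valMinAbs : ℤ) : ℝ)| + |(((q.2 1).valMinAbs : ℤ) : ℝ)|) ≤ R) := by
      intro q hq
      rw [mem_filter] at hq
      have hle : ff q ≤ R := hq.2
      refine mem_filter.2 ⟨mem_univ _, ?_, ?_⟩
      · have : X q ≤ R := by simp only [hff] at hle; linarith [hI₁0 q, hI₂0 q]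
        simpa [hX] using this
      · have : 1 + I₁ q + I₂ q ≤ R := by simp only [hff] at hle; linarith [hX0 q]
        simp only [hI₁, hI₂] at this; linarith
    have hprod := card_filter_prod_and_le (fun j : TorusSite 1 P => s₀ * |(((j 0).valMinAbs : ℤ) : ℝ)| ≤ R)
      (fun z : TorusSite 2 L => 1 + s₁ * (|(((z 0).valMinAbs : ℤ) : ℝ)| + |(((z 1).valMinAbs : ℤ) : ℝ)|) ≤ R)
      (fun q : TorusSite 1 P × TorusSite 2 L =>
        s₀ * |(((q.1 0).valMinAbs : ℤ) : ℝ)| ≤ R ∧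
        1 + s₁ * (|(((q.2 0).valMinAbs : ℤ) : ℝ)| + |(((q.2 1).valMinAbs : ℤ) : ℝ)|) ≤ R)
      (fun q h => h)
    have h1 := card_filter_time_le (P := P) hs₀ hR
    have h2 := card_filter_torus_l1_le (L := L) hs₁ hR
    calc (((Sf.filter fun q => ff q ≤ R).card : ℕ) : ℝ)
        ≤ ((univ.filter (fun j : TorusSite 1 P => s₀ * |(((j 0).valMinAbs : ℤ) : ℝ)| ≤ R)).card : ℝ) *
          ((univ.filter (fun z : TorusSite 2 L =>
            1 + s₁ * (|(((z 0).valMinAbs : ℤ) : ℝ)| + |(((z 1).valMinAbs : ℤ) : ℝ)|) ≤ R)).card : ℝ) := by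
          exact_mod_cast (card_le_card hsub).trans hprod
      _ ≤ (4 * (1 / s₀ + 1) * R) * (4 * (1 / s₁ + 1) ^ 2 * R ^ 2) := mul_le_mul h1 h2 (by positivity) (by positivity)
      _ = Af * R ^ 3 := by rw [hAf]; ring
  have hfar_min : ∀ q ∈ Sf, 1 + s₁ * R₀ ≤ ff q := by
    intro q hq
    have hq' : ¬ near q := (mem_filter.1 hq).2
    simp only [near, not_forall, not_le] at hq'
    obtain ⟨i, hi⟩ := hq'
    have hi' : (R₀ : ℝ) ≤ |(((q.2 i).valMinAbs : ℤ) : ℝ)| := by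
      rw [← Int.cast_abs]; exact_mod_cast hi.le
    have hsum : |(((q.2 i).valMinAbs : ℤ) : ℝ)| ≤ |(((q.2 0).valMinAbs : ℤ) : ℝ)| + |(((q.2 1).valMinAbs : ℤ) : ℝ)| := by
      have h := Finset.single_le_sum (f := fun i : Fin 2 => |(((q.2 i).valMinAbs : ℤ) : ℝ)|) (fun j _ => abs_nonneg _)
        (mem_univ i)
      rwa [Fin.sum_univ_two] at h
    have : s₁ * R₀ ≤ I₁ q + I₂ q := by
      simp only [hI₁, hI₂]; rw [← mul_add]; exact mul_le_mul_of_nonneg_left (hi'.trans hsum) hs₁.le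
    simp only [hff]; linarith [hX0 q]
  have hRmin : (1 : ℝ) ≤ 1 + s₁ * R₀ := le_add_of_nonneg_right (by positivity)
  have hfar_sum : ∑ q ∈ Sf, (ff q)⁻¹ ^ 4 ≤ 32 * Af / (1 + s₁ * R₀) :=
    sum_inv_pow_le_of_card_le_cubic Sf ff hRmin hfar_min hAf0 hcount_far le_rfl
  -- (5) assemble (the summand is `ff q ^ 2 * (…)⁻¹` by `rfl`)
  have hsplit := (sum_filter_add_sum_filter_not univ near
    (fun q : TorusSite 1 P × TorusSite 2 L => ff q ^ 2 * (1 + X q ^ 6 + I₁ q ^ 6 + I₂ q ^ 6 + Y q ^ 6 + Z q ^ 4 + Z' q ^ 6)⁻¹)).symm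
  calc ∑ q : TorusSite 1 P × TorusSite 2 L, ff q ^ 2 * (1 + X q ^ 6 + I₁ q ^ 6 + I₂ q ^ 6 + Y q ^ 6 + Z q ^ 4 + Z' q ^ 6)⁻¹
      = ∑ q ∈ Sn, ff q ^ 2 * (1 + X q ^ 6 + I₁ q ^ 6 + I₂ q ^ 6 + Y q ^ 6 + Z q ^ 4 + Z' q ^ 6)⁻¹ +
          ∑ q ∈ Sf, ff q ^ 2 * (1 + X q ^ 6 + I₁ q ^ 6 + I₂ q ^ 6 + Y q ^ 6 + Z q ^ 4 + Z' q ^ 6)⁻¹ := hsplit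
    _ ≤ ∑ q ∈ Sn, ff q ^ 2 * (1 + X q ^ 6 + Y q ^ 6 + Z q ^ 4 + Z' q ^ 6)⁻¹ + ∑ q ∈ Sf, 1024 * (ff q)⁻¹ ^ 4 :=
        add_le_add (sum_le_sum fun q _ => hnear_pt q) (sum_le_sum fun q _ => hfar_pt q)
    _ = ∑ q ∈ Sn, ff q ^ 2 * (1 + X q ^ 6 + Y q ^ 6 + Z q ^ 4 + Z' q ^ 6)⁻¹ + 1024 * ∑ q ∈ Sf, (ff q)⁻¹ ^ 4 := by rw [mul_sum]
    _ ≤ 131072 * An * Cw ^ 2 + 1024 * (32 * Af / (1 + s₁ * R₀)) := by gcongr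
    _ = 524288 * (1 / s₀ + 1) * (Cw ^ 2 * ((2 * Real.sqrt 2 / (s₂ * r) + 2) * (2 * Real.sqrt 2 / (s₃ * r) + 2))
          + (1 / s₁ + 1) ^ 2 / (1 + s₁ * R₀)) := by
        rw [hAn, hAf]
        have hden : (1 + s₁ * (R₀ : ℝ)) ≠ 0 := by positivity
        field_simp
        ring

end Summit.HubbardSuperconductivity.HubbardSuperconductivity.Theorems.TorusFourierL2

end
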